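import Summits.Ventures.YMGap.Census.MarkedPlaquetteTransport
import HarnessLib

/-!
# Venture YMGap, track (b) — Tomboulis's Proposition II.1 (i): `Z_Λ({c_j})` is increasing in each `c_j ≥ 0`,
# for every spin cut-off, by reflection positivity

HONEST FRAMING: venture file of the cell `pub-ymgap` (QuantumFields programme), track (b).  Proved here is the
PRINTED, undisputed finite-volume statement E. T. Tomboulis, arXiv:0707.2179, Prop. II.1 (i), eq. (2.12): with all
`c_j ≥ 0`, "`Z_Λ({c_j})` is an increasing function of each `c_j`" ("from reflection positivity (in planes without
sites)", App. A) — on the even symmetric torus `(ℤ/Lℤ)^d`, for every spin cut-off `J` of `TomboulisVortexDecimation`: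
the tree's `Prop` `Tomboulis2007.CoeffMonotone d L J` (monotonicity of `torusZ` along the coefficient order between
admissible coefficient vectors) HOLDS for even `L`.  Nothing here concerns (5.15), the thermodynamic limit, confinement
or a mass gap; odd `L` (no reflection hyperplane between slices) is not covered.

## Proof

For one coefficient `c_k` (`1 ≤ k ≤ J`), `τ ↦ Z(c + τ e_k) = ∫ ∏_p (f_c(U_p) + τ d_k χ_k(U_p)) dU` is differentiable
with derivative `Σ_{p₀} ∫ d_k χ_k(U_{p₀}) ∏_{p ≠ p₀} f_{c + τ e_k}(U_p) dU` (differentiation under the integral sign,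
`hasDerivAt_integral_of_dominated_loc_of_deriv_le`; the integrand is a polynomial in `τ` with continuous bounded
coefficients).  Each term is a MARKED-PLAQUETTE INTEGRAL (`CrossingWeightRP.markedIntegral`), non-negative when `p₀`
is bisected by a reflection hyperplane (`markedIntegral_nonneg_of_isCrossPlaq`: Osterwalder–Seiler reflection
positivity with the character `d_k χ_k` on `p₀`, a positive-semidefinite kernel by the character convolution identity,
and `f_{c+τe_k}` elsewhere); every plaquette of the symmetric torus is carried to such a position by a transposition of
the axes (`configTranspose` of `TwistedPartitionFunction`) and a lattice translation (`configShift` of `MarkedPlaquetteTransport`), both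
of which preserve the product Haar measure and the marked integral (`MarkedPlaquetteTransport.markedIntegral_nonneg`).
Hence the derivative is `≥ 0` for `τ ≥ 0` and `Z` is monotone in `c_k` (`monotoneOn_of_deriv_nonneg`); composing over
the coordinates `k = 1, …, J` gives II.1 (i).

## Main statements (namespace `Summit.Ventures.YMGap.Census`)

* `plaqFn_update`, `dIntegrand`, `dIntegrand_eq_sum_markedFn`, `lineFn` — the integrand of `Z(c + τ e_k)` and its
  `τ`-derivative, a sum of marked-plaquette integrands.
* `hasDerivAt_torusZ_update` — `d/dτ Z(c + τ e_k) = Σ_{p₀} markedIntegral`.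
* `torusZ_update_mono` — monotone in one coefficient; **`coeffMonotone : Even L → CoeffMonotone d L J`**.

References: E. T. Tomboulis, arXiv:0707.2179, Prop. II.1 (i) eq. (2.12), App. A
[cite: Tomboulis2007Confinement, Prop. II.1 (i) eq. (2.12); App. A]; K. Osterwalder, E. Seiler, Ann. Phys. 110 (1978)
440, §2 [cite: OsterwalderSeilerAnnPhys1978, §2].
-/

noncomputable section

open MeasureTheory Finset Real
open scoped BigOperators
open Literature.MathematicalPhysics.QuantumLattice
open Literature.MathematicalPhysics.QuantumFieldTheory
open Literature.MathematicalPhysics.QuantumFieldTheory.Tomboulis2007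
open Literature.MathematicalPhysics.QuantumFieldTheory.WilsonRP

namespace Summit.Ventures.YMGap.Census

variable {d L : ℕ}

section Marked

variable [NeZero d] [NeZero L] [Fact (1 < L)]

/-! ### The derivative of `Z` along one coefficient -/

/-- Changing the single coefficient `c_k` by `τ`: `f_{c + τ e_k} = f_c + τ (k+1) χ_k` (`1 ≤ k ≤ J`). -/
theorem plaqFn_update (J : ℕ) (c : ℕ → ℝ) {k : ℕ} (hk1 : 1 ≤ k) (hkJ : k ≤ J) (τ : ℝ) (W : SU2) :
    plaqFn J (Function.update c k (c k + τ)) W = plaqFn J c W + τ * (((k : ℝ) + 1) * su2Char k W) := by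
  unfold plaqFn
  have hk : k ∈ Icc 1 J := Finset.mem_Icc.2 ⟨hk1, hkJ⟩
  have hsplit : ∀ c' : ℕ → ℝ, ∑ n ∈ Icc 1 J, ((n : ℝ) + 1) * c' n * su2Char n W =
      ((k : ℝ) + 1) * c' k * su2Char k W + ∑ n ∈ (Icc 1 J).erase k, ((n : ℝ) + 1) * c' n * su2Char n W :=
    fun c' => (Finset.add_sum_erase _ _ hk).symm
  rw [hsplit, hsplit c, Function.update_self]
  have hrest : ∑ n ∈ (Icc 1 J).erase k, ((n : ℝ) + 1) * Function.update c k (c k + τ) n * su2Char n W =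
      ∑ n ∈ (Icc 1 J).erase k, ((n : ℝ) + 1) * c n * su2Char n W :=
    Finset.sum_congr rfl fun n hn => by rw [Function.update_of_ne (Finset.mem_erase.1 hn).1]
  rw [hrest]
  ring

omit [NeZero d] [Fact (1 < L)] in
/-- The integrand of `Z(c + τ e_k)` as a product of affine functions of `τ`. -/
theorem torusZ_update_integrand (J : ℕ) (c : ℕ → ℝ) {k : ℕ} (hk1 : 1 ≤ k) (hkJ : k ≤ J) (τ : ℝ)
    (W : GaugeConfig d L SU2) :
    ∏ p : Plaquette d L, plaqFn J (Function.update c k (c k + τ)) (plaquetteHolonomy W p.1 p.2.1.1 p.2.1.2) =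
      ∏ p : Plaquette d L, (plaqFn J c (plaquetteHolonomy W p.1 p.2.1.1 p.2.1.2) +
        τ * (((k : ℝ) + 1) * su2Char k (plaquetteHolonomy W p.1 p.2.1.1 p.2.1.2))) :=
  Finset.prod_congr rfl fun _ _ => plaqFn_update J c hk1 hkJ τ _

/-- The `τ`-derivative of the integrand: `Σ_{p₀} (∏_{p ≠ p₀} f_{c+τe_k}(U_p)) · (k+1) χ_k(U_{p₀})`. -/
def dIntegrand (J : ℕ) (c : ℕ → ℝ) (k : ℕ) (τ : ℝ) (W : GaugeConfig d L SU2) : ℝ :=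
  ∑ p₀ : Plaquette d L, (∏ p ∈ univ.erase p₀, (plaqFn J c (plaquetteHolonomy W p.1 p.2.1.1 p.2.1.2) +
      τ * (((k : ℝ) + 1) * su2Char k (plaquetteHolonomy W p.1 p.2.1.1 p.2.1.2)))) *
    (((k : ℝ) + 1) * su2Char k (plaquetteHolonomy W p₀.1 p₀.2.1.1 p₀.2.1.2))

omit [NeZero d] [Fact (1 < L)] in
/-- Pointwise differentiability of the integrand in `τ` (product rule, `HasDerivAt.finsetProd`). -/
theorem hasDerivAt_integrand (J : ℕ) (c : ℕ → ℝ) (k : ℕ) (W : GaugeConfig d L SU2) (τ : ℝ) :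
    HasDerivAt (fun s : ℝ => ∏ p : Plaquette d L, (plaqFn J c (plaquetteHolonomy W p.1 p.2.1.1 p.2.1.2) +
        s * (((k : ℝ) + 1) * su2Char k (plaquetteHolonomy W p.1 p.2.1.1 p.2.1.2))))
      (dIntegrand J c k τ W) τ := by
  have h : HasDerivAt (∏ p ∈ (univ : Finset (Plaquette d L)), fun s : ℝ =>
      plaqFn J c (plaquetteHolonomy W p.1 p.2.1.1 p.2.1.2) +
        s * (((k : ℝ) + 1) * su2Char k (plaquetteHolonomy W p.1 p.2.1.1 p.2.1.2)))
      (∑ p₀ ∈ (univ : Finset (Plaquette d L)), (∏ p ∈ univ.erase p₀,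
        (plaqFn J c (plaquetteHolonomy W p.1 p.2.1.1 p.2.1.2) +
          τ * (((k : ℝ) + 1) * su2Char k (plaquetteHolonomy W p.1 p.2.1.1 p.2.1.2)))) •
        (((k : ℝ) + 1) * su2Char k (plaquetteHolonomy W p₀.1 p₀.2.1.1 p₀.2.1.2))) τ :=
    HasDerivAt.finsetProd fun p _ => (hasDerivAt_mul_const _).const_add _
  have hfun : (fun s : ℝ => ∏ p : Plaquette d L, (plaqFn J c (plaquetteHolonomy W p.1 p.2.1.1 p.2.1.2) +
        s * (((k : ℝ) + 1) * su2Char k (plaquetteHolonomy W p.1 p.2.1.1 p.2.1.2)))) =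
      ∏ p ∈ (univ : Finset (Plaquette d L)), fun s : ℝ =>
        plaqFn J c (plaquetteHolonomy W p.1 p.2.1.1 p.2.1.2) +
          s * (((k : ℝ) + 1) * su2Char k (plaquetteHolonomy W p.1 p.2.1.1 p.2.1.2)) := by
    funext s
    simp only [Finset.prod_apply]
  rw [hfun]
  unfold dIntegrand
  simpa only [smul_eq_mul] using h

omit [NeZero d] [Fact (1 < L)] in
/-- The `p₀`-term of the derivative at `τ` is the marked integrand for the coefficients `c + τ e_k`. -/
theorem dIntegrand_eq_sum_markedFn (J : ℕ) (c : ℕ → ℝ) {k : ℕ} (hk1 : 1 ≤ k) (hkJ : k ≤ J) (τ : ℝ)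
    (W : GaugeConfig d L SU2) :
    dIntegrand J c k τ W = ∑ p₀ : Plaquette d L, markedFn J (Function.update c k (c k + τ)) k p₀ W := by
  unfold dIntegrand markedFn
  refine Finset.sum_congr rfl fun p₀ _ => ?_
  rw [← Finset.mul_prod_erase univ _ (Finset.mem_univ p₀), if_pos rfl, mul_comm]
  congr 1
  exact Finset.prod_congr rfl fun p hp => by
    rw [if_neg (Finset.mem_erase.1 hp).1, plaqFn_update J c hk1 hkJ]

/-! #### Continuity and bounds (compactness) -/

omit [NeZero d] [NeZero L] [Fact (1 < L)] in
/-- `W ↦ U_p` is continuous. -/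
theorem continuous_hol (p : Plaquette d L) :
    Continuous fun W : GaugeConfig d L SU2 => plaquetteHolonomy W p.1 p.2.1.1 p.2.1.2 := by
  unfold plaquetteHolonomy
  fun_prop

omit [NeZero d] [NeZero L] [Fact (1 < L)] in
/-- The characters are continuous. -/
theorem continuous_su2Char' (n : ℕ) : Continuous (su2Char n) := by
  have h : su2Char n = fun W => charR n (2 * Summit.Ventures.LatticeQCDFlow.Exactness.su2a0 W) := by
    funext W
    simp only [su2Char, charR, Summit.Ventures.LatticeQCDFlow.Exactness.su2a0]
    ring_nf
  rw [h]
  exact (continuous_charR n).comp (continuous_const.mul Summit.Ventures.LatticeQCDFlow.Exactness.continuous_su2a0)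

omit [NeZero d] [NeZero L] [Fact (1 < L)] in
/-- The plaquette function is continuous on `SU(2)`. -/
theorem continuous_plaqFn' (J : ℕ) (c : ℕ → ℝ) : Continuous (plaqFn J c) := by
  unfold plaqFn
  exact continuous_const.add (continuous_finsetSum _ fun n _ => continuous_const.mul (continuous_su2Char' n))

omit [NeZero d] [Fact (1 < L)] in
/-- The derivative integrand `(τ, W) ↦ dIntegrand τ W` is jointly continuous. -/
theorem continuous_dIntegrand₂ (J : ℕ) (c : ℕ → ℝ) (k : ℕ) :
    Continuous fun z : ℝ × GaugeConfig d L SU2 => dIntegrand J c k z.1 z.2 := by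
  unfold dIntegrand
  refine continuous_finsetSum _ fun p₀ _ => ?_
  have h1 : ∀ p : Plaquette d L,
      Continuous fun z : ℝ × GaugeConfig d L SU2 => plaquetteHolonomy z.2 p.1 p.2.1.1 p.2.1.2 := fun p =>
    (continuous_hol p).comp continuous_snd
  refine (continuous_finsetProd _ fun p _ => ?_).mul (continuous_const.mul ((continuous_su2Char' k).comp (h1 p₀)))
  exact ((continuous_plaqFn' J c).comp (h1 p)).add
    (continuous_fst.mul (continuous_const.mul ((continuous_su2Char' k).comp (h1 p))))

/-- The integrand of `Z(c + τ e_k)`: `∏_p (f_c(U_p) + τ (k+1) χ_k(U_p))`. -/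
def lineFn (J : ℕ) (c : ℕ → ℝ) (k : ℕ) (τ : ℝ) (W : GaugeConfig d L SU2) : ℝ :=
  ∏ p : Plaquette d L, (plaqFn J c (plaquetteHolonomy W p.1 p.2.1.1 p.2.1.2) +
    τ * (((k : ℝ) + 1) * su2Char k (plaquetteHolonomy W p.1 p.2.1.1 p.2.1.2)))

omit [NeZero d] [Fact (1 < L)] in
/-- `Z(c + τ e_k) = ∫ lineFn τ`. -/
theorem torusZ_update_eq (J : ℕ) (c : ℕ → ℝ) {k : ℕ} (hk1 : 1 ≤ k) (hkJ : k ≤ J) (τ : ℝ) :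
    torusZ d L J (Function.update c k (c k + τ)) =
      ∫ W, lineFn J c k τ W ∂(Measure.pi fun _ : Edge d L => haarProbability SU2) := by
  unfold torusZ lineFn
  exact integral_congr_ae (ae_of_all _ fun W => torusZ_update_integrand J c hk1 hkJ τ W)

omit [NeZero d] [Fact (1 < L)] in
/-- `lineFn τ` is continuous in the configuration. -/
theorem continuous_lineFn (J : ℕ) (c : ℕ → ℝ) (k : ℕ) (τ : ℝ) :
    Continuous fun W : GaugeConfig d L SU2 => lineFn J c k τ W := by
  unfold lineFn
  refine continuous_finsetProd _ fun p _ => ?_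
  exact ((continuous_plaqFn' J c).comp (continuous_hol p)).add
    (continuous_const.mul (continuous_const.mul ((continuous_su2Char' k).comp (continuous_hol p))))

omit [NeZero d] [Fact (1 < L)] in
/-- `dIntegrand τ` is continuous in the configuration. -/
theorem continuous_dIntegrand (J : ℕ) (c : ℕ → ℝ) (k : ℕ) (τ : ℝ) :
    Continuous fun W : GaugeConfig d L SU2 => dIntegrand J c k τ W := by
  unfold dIntegrand
  refine continuous_finsetSum _ fun p₀ _ => ?_
  refine (continuous_finsetProd _ fun p _ => ?_).mul
    (continuous_const.mul ((continuous_su2Char' k).comp (continuous_hol p₀)))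
  exact ((continuous_plaqFn' J c).comp (continuous_hol p)).add
    (continuous_const.mul (continuous_const.mul ((continuous_su2Char' k).comp (continuous_hol p))))

omit [NeZero d] [Fact (1 < L)] in
/-- `lineFn · W` has derivative `dIntegrand · W`. -/
theorem hasDerivAt_lineFn (J : ℕ) (c : ℕ → ℝ) (k : ℕ) (W : GaugeConfig d L SU2) (τ : ℝ) :
    HasDerivAt (fun s : ℝ => lineFn J c k s W) (dIntegrand J c k τ W) τ := by
  unfold lineFn
  exact hasDerivAt_integrand J c k W τ

omit [NeZero d] [Fact (1 < L)] in
/-- **Differentiation under the integral sign**: `τ ↦ Z(c + τ e_k)` has derivative `∫ dIntegrand τ dU` at every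
`τ` (the integrand is continuous and bounded together with its `τ`-derivative on `[τ-1, τ+1] × SU(2)^{links}`,
compact; `hasDerivAt_integral_of_dominated_loc_of_deriv_le`). -/
theorem hasDerivAt_torusZ_update (J : ℕ) (c : ℕ → ℝ) {k : ℕ} (hk1 : 1 ≤ k) (hkJ : k ≤ J) (τ₀ : ℝ) :
    HasDerivAt (fun τ => torusZ d L J (Function.update c k (c k + τ)))
      (∫ W, dIntegrand J c k τ₀ W ∂(Measure.pi fun _ : Edge d L => haarProbability SU2)) τ₀ := by
  haveI : SecondCountableTopology SU2 := secondCountableTopology_su2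
  have hZ : (fun τ => torusZ d L J (Function.update c k (c k + τ))) =
      fun τ => ∫ W, lineFn J c k τ W ∂(Measure.pi fun _ : Edge d L => haarProbability SU2) :=
    funext fun τ => torusZ_update_eq J c hk1 hkJ τ
  rw [hZ]
  have hFc : ∀ τ : ℝ, Continuous fun W : GaugeConfig d L SU2 => lineFn J c k τ W := fun τ =>
    continuous_lineFn J c k τ
  have hDc : ∀ τ : ℝ, Continuous fun W : GaugeConfig d L SU2 => dIntegrand J c k τ W := fun τ =>
    continuous_dIntegrand J c k τ
  have hK : IsCompact (Metric.closedBall τ₀ 1 ×ˢ (Set.univ : Set (GaugeConfig d L SU2))) :=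
    (isCompact_closedBall τ₀ 1).prod isCompact_univ
  obtain ⟨K, hKb⟩ := hK.exists_bound_of_continuousOn (continuous_dIntegrand₂ J c k).continuousOn
  have hbound : ∀ᵐ W ∂(Measure.pi fun _ : Edge d L => haarProbability SU2), ∀ τ ∈ Metric.ball τ₀ 1,
      ‖dIntegrand J c k τ W‖ ≤ K :=
    ae_of_all _ fun W τ hτ => hKb (τ, W) ⟨Metric.ball_subset_closedBall hτ, Set.mem_univ _⟩
  have key := hasDerivAt_integral_of_dominated_loc_of_deriv_le
    (μ := Measure.pi fun _ : Edge d L => haarProbability SU2) (F := lineFn J c k) (F' := dIntegrand J c k)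
    (x₀ := τ₀) (bound := fun _ => K) (Metric.ball_mem_nhds τ₀ one_pos)
    (Filter.Eventually.of_forall fun τ => (hFc τ).aestronglyMeasurable)
    (integrable_of_continuous_fin (hFc τ₀)) ((hDc τ₀).aestronglyMeasurable) hbound (integrable_const K)
    (ae_of_all _ fun W τ _ => hasDerivAt_lineFn J c k W τ)
  exact key.2

omit [NeZero d] [Fact (1 < L)] in
/-- **The derivative of `Z(c + τ e_k)` is the sum of the marked integrals** (coefficients `c + τ e_k`). -/
theorem integral_dIntegrand_eq (J : ℕ) (c : ℕ → ℝ) {k : ℕ} (hk1 : 1 ≤ k) (hkJ : k ≤ J) (τ : ℝ) :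
    ∫ W, dIntegrand J c k τ W ∂(Measure.pi fun _ : Edge d L => haarProbability SU2) =
      ∑ p₀ : Plaquette d L, markedIntegral J (Function.update c k (c k + τ)) k p₀ := by
  haveI : SecondCountableTopology SU2 := secondCountableTopology_su2
  simp_rw [dIntegrand_eq_sum_markedFn J c hk1 hkJ τ, markedIntegral_eq]
  refine integral_finsetSum _ fun p₀ _ => integrable_of_continuous_fin ?_
  unfold markedFn
  refine continuous_finsetProd _ fun p _ => ?_
  split_ifs
  · exact continuous_const.mul ((continuous_su2Char' k).comp (continuous_hol p))
  · exact (continuous_plaqFn' J _).comp (continuous_hol p)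

/-- **`Z` is increasing in the coefficient `c_k`** (arXiv:0707.2179 Prop. II.1 (i), one coordinate): on the even
torus, for `c_j ≥ 0` (`j ≠ 0`), `1 ≤ k ≤ J` and `0 ≤ τ`, `Z(c) ≤ Z(c + τ e_k)`. -/
theorem torusZ_update_mono (hL : Even L) (J : ℕ) {c : ℕ → ℝ} (hc : ∀ n, 1 ≤ n → 0 ≤ c n) {k : ℕ}
    (hk1 : 1 ≤ k) (hkJ : k ≤ J) {τ : ℝ} (hτ : 0 ≤ τ) :
    torusZ d L J c ≤ torusZ d L J (Function.update c k (c k + τ)) := by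
  set Zl : ℝ → ℝ := fun s => torusZ d L J (Function.update c k (c k + s)) with hZl
  have hderiv : ∀ s, HasDerivAt Zl (∫ W, dIntegrand J c k s W ∂(Measure.pi fun _ : Edge d L =>
      haarProbability SU2)) s := fun s => hasDerivAt_torusZ_update J c hk1 hkJ s
  have hmono : MonotoneOn Zl (Set.Ici 0) := by
    refine monotoneOn_of_deriv_nonneg (convex_Ici 0) ?_ ?_ ?_
    · exact HasDerivAt.continuousOn fun s _ => hderiv s
    · exact fun s _ => (hderiv s).differentiableAt.differentiableWithinAt
    · intro s hs
      rw [interior_Ici] at hs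
      rw [(hderiv s).deriv, integral_dIntegrand_eq J c hk1 hkJ s]
      refine Finset.sum_nonneg fun p₀ _ => markedIntegral_nonneg hL J (fun n hn => ?_) hkJ p₀
      by_cases hnk : n = k
      · subst hnk; rw [Function.update_self]; exact add_nonneg (hc n hn) (le_of_lt hs)
      · rw [Function.update_of_ne hnk]; exact hc n hn
  have h0 : Zl 0 = torusZ d L J c := by
    simp only [hZl, add_zero, Function.update_eq_self]
  rw [← h0]
  exact hmono (Set.mem_Ici.2 le_rfl) (Set.mem_Ici.2 hτ) hτ

/-- **Prop. II.1 (i) in its printed form, `∂Z_Λ({c_i})/∂c_k ≥ 0`** (arXiv:0707.2179 eq. (2.12)): on the even torus, for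
every spin cut-off `J`, `c_j ≥ 0` (`j ≠ 0`) and `1 ≤ k ≤ J`, the partial derivative of `Z_Λ` in the coordinate `c_k` exists
and is non-negative. -/
theorem deriv_torusZ_coord_nonneg (hL : Even L) (J : ℕ) {c : ℕ → ℝ} (hc : ∀ n, 1 ≤ n → 0 ≤ c n) {k : ℕ}
    (hk1 : 1 ≤ k) (hkJ : k ≤ J) :
    DifferentiableAt ℝ (fun τ => torusZ d L J (Function.update c k (c k + τ))) 0 ∧
      0 ≤ deriv (fun τ => torusZ d L J (Function.update c k (c k + τ))) 0 := by
  have h := hasDerivAt_torusZ_update (d := d) (L := L) J c hk1 hkJ 0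
  refine ⟨h.differentiableAt, ?_⟩
  rw [h.deriv, integral_dIntegrand_eq J c hk1 hkJ 0]
  refine Finset.sum_nonneg fun p₀ _ => markedIntegral_nonneg hL J (fun n hn => ?_) hkJ p₀
  rw [add_zero, Function.update_eq_self]
  exact hc n hn

/-! ### Prop. II.1 (i): composing over the coordinates -/

omit [NeZero d] [Fact (1 < L)] in
/-- `Z_Λ` depends only on the coefficients `c_1, …, c_J`. -/
theorem torusZ_congr (J : ℕ) {c₁ c₂ : ℕ → ℝ} (h : ∀ n ∈ Icc 1 J, c₁ n = c₂ n) :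
    torusZ d L J c₁ = torusZ d L J c₂ := by
  unfold torusZ
  refine integral_congr_ae (ae_of_all _ fun W => Finset.prod_congr rfl fun p _ => ?_)
  unfold plaqFn
  rw [Finset.sum_congr rfl fun n hn => by rw [h n hn]]

/-- **Tomboulis's Prop. II.1 (i) (arXiv:0707.2179 eq. (2.12)) for every spin cut-off, on the even torus**:
`Z_Λ({c_j})` is increasing along the coefficient order between admissible coefficient vectors —
`Tomboulis2007.CoeffMonotone d L J`. -/
theorem coeffMonotone (hL : Even L) (J : ℕ) : CoeffMonotone d L J := by
  intro c c' hc hc' hle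
  -- hybrid vectors: `c'` below `m`, `c` from `m` on
  let mix : ℕ → ℕ → ℝ := fun m n => if n < m then c' n else c n
  have hmix_nonneg : ∀ m n, 1 ≤ n → 0 ≤ mix m n := fun m n hn => by
    simp only [mix]
    split_ifs
    · exact (hc' n hn).1
    · exact (hc n hn).1
  have hstep : ∀ m, torusZ d L J c ≤ torusZ d L J (mix m) := by
    intro m
    induction m with
    | zero =>
      have : mix 0 = c := funext fun n => by simp [mix]
      rw [this]
    | succ m ih =>
      have hupd : mix (m + 1) = Function.update (mix m) m (mix m m + (c' m - c m)) := by
        funext n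
        by_cases hnm : n = m
        · subst hnm
          rw [Function.update_self]
          simp [mix]
        · rw [Function.update_of_ne hnm]
          simp only [mix]
          have : n < m + 1 ↔ n < m := by omega
          simp only [this]
      refine ih.trans ?_
      rw [hupd]
      by_cases hm : m ∈ Icc 1 J
      · exact torusZ_update_mono hL J (hmix_nonneg m) (Finset.mem_Icc.1 hm).1 (Finset.mem_Icc.1 hm).2
          (sub_nonneg.2 (hle m))
      · exact le_of_eq (torusZ_congr J fun n hn => by
          rw [Function.update_of_ne (fun h => hm (by rw [← h]; exact hn))])
  refine (hstep (J + 1)).trans (le_of_eq (torusZ_congr J fun n hn => ?_))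
  have : n < J + 1 := Nat.lt_succ_of_le (Finset.mem_Icc.1 hn).2
  simp [mix, this]

end Marked

end Summit.Ventures.YMGap.Census

end
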